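import Literature.NumberTheory.Sieve.FriableMoebiusRootSumMainSum
import HarnessLib

/-!
# Prime sums of the Buchstab iteration for the friable Möbius–root sum, III: the main sum for `k = 2`

Topic `Literature/NumberTheory/Sieve` (sequel to `FriableMoebiusRootSumMainSum.lean`). Everything
here is PROVED; no definitions, no named facts. On the Buchstab range `y ≤ p < z = x^{1/2}` with
`u = log x/log y ≤ 3` the argument `s = log x/log p − 1` lies in `(1, 2]`, where `ω(s) = 1/s`, so
the summand `(r(p)/p) ω(s)/log p` is `(r(p)/p)/(log x − log p)`; Abel summation against `log log`
with the weight `G(v) = 1/(log x (1 − v))` and `∫_α^β dv/(v(1−v)) = [log v − log(1 − v)]_α^β`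
give the main term `log(u − 1)/log x = (u ω(u) − 2 ω(2))/log x`:

* `abs_sum_prime_buchstabWeight_sub_main_le_two` — `k = 2`: `… ≤ (3 C_E + 12)/log² a`;
* `abs_sum_prime_buchstabWeight_sub_main_le` — the combined statement for every `k ≥ 2`:
  `|∑_p (r(p)/p) ω(log x/log p − 1)/log p − (u ω(u) − k ω(k))/log x| ≤ ((2 + (k+3)³) C_E + 12 + 4k)/log² a`.

## References

* G. Tenenbaum, *Introduction to analytic and probabilistic number theory*, 3rd ed., AMS 2015,
  Ch. III.6. [Tenenbaum2015]
-/

open Finset Real MeasureTheory Set intervalIntegral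

noncomputable section

namespace Literature.NumberTheory.Sieve

namespace FriableMoebiusRoot

/-! ### The main sum, `k = 2`: three lemmas -/

/-- Endpoint comparison at `α`: for `0 < α ≤ α₀ ≤ 1/2` with `α₀ − α ≤ δ`,
`(log(1 − α) − log(1 − α₀)) + (log α₀ − log α) ≤ 2δ + δ/α`, and both brackets are `≥ 0`.
[folklore] -/
theorem log_endpoint_alpha_le {α α₀ δ : ℝ} (hα : 0 < α) (hαα₀ : α ≤ α₀) (hα₀ : α₀ ≤ 1 / 2)
    (hδ : α₀ - α ≤ δ) :
    0 ≤ (Real.log (1 - α) - Real.log (1 - α₀)) + (Real.log α₀ - Real.log α) ∧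
      (Real.log (1 - α) - Real.log (1 - α₀)) + (Real.log α₀ - Real.log α) ≤ 2 * δ + δ / α := by
  have hα₀0 : 0 < α₀ := hα.trans_le hαα₀
  have hαα : 0 ≤ α₀ - α := by linarith
  have e1' : 0 ≤ Real.log (1 - α) - Real.log (1 - α₀) :=
    sub_nonneg.mpr (Real.log_le_log (by linarith : (0:ℝ) < 1 - α₀) (by linarith : 1 - α₀ ≤ 1 - α))
  have e2' : 0 ≤ Real.log α₀ - Real.log α := sub_nonneg.mpr (Real.log_le_log hα hαα₀)
  refine ⟨by linarith, ?_⟩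
  have e1 : Real.log (1 - α) - Real.log (1 - α₀) ≤ 2 * δ := by
    rw [← Real.log_div (by linarith) (by linarith)]
    have := Real.log_le_sub_one_of_pos (div_pos (by linarith : (0:ℝ) < 1 - α) (by linarith : (0:ℝ) < 1 - α₀))
    have h2 : (1 - α) / (1 - α₀) - 1 = (α₀ - α) / (1 - α₀) := by
      rw [div_sub_one (by linarith : (1 - α₀) ≠ 0)]; ring
    have h3 : (α₀ - α) / (1 - α₀) ≤ 2 * δ := by
      rw [div_le_iff₀ (by linarith : (0:ℝ) < 1 - α₀)]
      have : (α₀ - α) * 1 ≤ (α₀ - α) * (2 * (1 - α₀)) := mul_le_mul_of_nonneg_left (by linarith) hαα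
      nlinarith
    linarith
  have e2 : Real.log α₀ - Real.log α ≤ δ / α := by
    rw [← Real.log_div hα₀0.ne' hα.ne']
    have := Real.log_le_sub_one_of_pos (div_pos hα₀0 hα)
    have h2 : α₀ / α - 1 = (α₀ - α) / α := by field_simp
    have h3 : (α₀ - α) / α ≤ δ / α := div_le_div_of_nonneg_right hδ hα.le
    linarith
  linarith

/-- Endpoint comparison at `β`: for `0 < β ≤ 1/2`, `0 ≤ log(1 − β) − log β ≤ (1 − 2β)/β`. [folklore] -/
theorem log_endpoint_beta_le {β : ℝ} (hβ : 0 < β) (hβh : β ≤ 1 / 2) :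
    0 ≤ Real.log (1 - β) - Real.log β ∧ Real.log (1 - β) - Real.log β ≤ (1 - 2 * β) / β := by
  refine ⟨sub_nonneg.mpr (Real.log_le_log hβ (by linarith)), ?_⟩
  rw [← Real.log_div (by linarith) hβ.ne']
  have h2 := Real.log_le_sub_one_of_pos (div_pos (by linarith : (0:ℝ) < 1 - β) hβ)
  have h3 : (1 - β) / β - 1 = (1 - 2 * β) / β := by field_simp; ring
  linarith

/-- **The `k = 2` prime sum against `log log`**: for `e ≤ a ≤ b`, `0 < x`, `2 log b < log x =: L`,
`2 ≤ L` and Mertens' hypothesis with rate,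
`|∑_{⌊a⌋ < p ≤ ⌊b⌋} (r(p)/p)/(L − log p) − (F(β) − F(α))/L| ≤ 3 C_E/log² a`,
`F(v) = log v − log(1 − v)`, `α = log a/L`, `β = log b/L` (weight `G(v) = 1/(L(1 − v))`).
[cite: Tenenbaum2015, Ch. III.6] -/
theorem abs_sum_prime_div_sub_log_sub_main_le {r : ℕ → ℝ} {b₀ CE : ℝ}
    (hM : ∀ t : ℝ, 2 ≤ t → |∑ p ∈ Nat.primesLE ⌊t⌋₊, r p / p - (Real.log (Real.log t) + b₀)| ≤
      CE / Real.log t ^ 2)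
    {x a b : ℝ} (ha : Real.exp 1 ≤ a) (hab : a ≤ b) (hx : 0 < x) (hbL : 2 * Real.log b < Real.log x)
    (hL2 : 2 ≤ Real.log x) :
    |∑ p ∈ (Finset.Ioc ⌊a⌋₊ ⌊b⌋₊).filter Nat.Prime, r p / p * (1 / (Real.log x - Real.log p)) -
      1 / Real.log x * ((Real.log (Real.log b / Real.log x) - Real.log (1 - Real.log b / Real.log x)) -
        (Real.log (Real.log a / Real.log x) - Real.log (1 - Real.log a / Real.log x)))| ≤
      3 * CE / Real.log a ^ 2 := by
  set L := Real.log x with hL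
  set α := Real.log a / L with hα
  set β := Real.log b / L with hβ
  have hCE : 0 ≤ CE := mertensConst_nonneg hM
  have ha0 : 0 < a := (Real.exp_pos 1).trans_le ha
  have hla1 : 1 ≤ Real.log a := by rw [Real.le_log_iff_exp_le ha0]; exact ha
  have hla : 0 < Real.log a := by linarith
  have hb0 : 0 < b := ha0.trans_le hab
  have hlab : Real.log a ≤ Real.log b := Real.log_le_log ha0 hab
  have hL0 : 0 < L := by linarith
  have hbx : b < x := by
    by_contra h
    push Not at h
    linarith [Real.log_le_log hx h]
  have ha2 : 2 ≤ a := le_trans (by have := Real.add_one_le_exp (1 : ℝ); linarith) ha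
  have hα0 : 0 < α := div_pos hla hL0
  have hαβ : α ≤ β := div_le_div_of_nonneg_right hlab hL0.le
  have hβhalf : β < 1 / 2 := by simp only [hβ]; rw [div_lt_iff₀ hL0]; linarith
  have hv1 : ∀ v ∈ Set.Icc α β, 0 < v ∧ 1 / 2 < 1 - v := fun v hv =>
    ⟨hα0.trans_le hv.1, by linarith [hv.2]⟩
  -- the weight `G(v) = 1/(L(1 − v))`
  set G : ℝ → ℝ := fun v => 1 / (L * (1 - v)) with hG
  set G' : ℝ → ℝ := fun v => 1 / (L * (1 - v) ^ 2) with hG'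
  have hGd : ∀ v ∈ Set.Icc α β, HasDerivAt G (G' v) v := by
    intro v hv
    obtain ⟨hv0, hv1'⟩ := hv1 v hv
    have h0 : HasDerivAt (fun v : ℝ => L * (1 - v)) (L * (0 - 1)) v :=
      ((hasDerivAt_const v (1:ℝ)).sub (hasDerivAt_id v)).const_mul L
    have h1 : HasDerivAt (fun v : ℝ => (L * (1 - v))⁻¹) (-(L * (0 - 1)) / (L * (1 - v)) ^ 2) v :=
      h0.fun_inv (by positivity)
    have h2 : HasDerivAt G (-(L * (0 - 1)) / (L * (1 - v)) ^ 2) v := by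
      refine h1.congr_of_eventuallyEq (Filter.Eventually.of_forall fun s => ?_)
      simp only [hG, one_div]
    refine h2.congr_deriv ?_
    simp only [hG']
    have : (1 - v) ≠ 0 := by linarith
    field_simp
    norm_num
  have hG'c : ContinuousOn G' (Set.Icc α β) := by
    simp only [hG']
    refine continuousOn_const.div (continuousOn_const.mul ((continuousOn_const.sub continuousOn_id).pow 2))
      fun v hv => ?_
    have := (hv1 v hv).2
    positivity
  have hwrap := abs_primeSum_sub_integral_le hM ha2 hab hbx hGd hG'c
  have hsumG : ∑ p ∈ (Finset.Ioc ⌊a⌋₊ ⌊b⌋₊).filter Nat.Prime, r p / p * G (Real.log p / L) =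
      ∑ p ∈ (Finset.Ioc ⌊a⌋₊ ⌊b⌋₊).filter Nat.Prime, r p / p * (1 / (L - Real.log p)) := by
    refine Finset.sum_congr rfl fun p _ => ?_
    simp only [hG]
    rw [mul_sub, mul_one, mul_div_cancel₀ _ hL0.ne']
  rw [hsumG] at hwrap
  -- the main integral
  set F : ℝ → ℝ := fun v => Real.log v - Real.log (1 - v) with hF
  have hmain : ∫ v in α..β, G v / v = 1 / L * (F β - F α) := by
    have hderiv : ∀ v ∈ Set.uIcc α β, HasDerivAt (fun v => 1 / L * F v) (G v / v) v := by
      intro v hv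
      rw [Set.uIcc_of_le hαβ] at hv
      obtain ⟨hv0, hv1'⟩ := hv1 v hv
      have h0 : HasDerivAt (fun w : ℝ => 1 - w) (0 - 1) v := (hasDerivAt_const v 1).sub (hasDerivAt_id v)
      have h1 : HasDerivAt F (v⁻¹ - (0 - 1) / (1 - v)) v :=
        (Real.hasDerivAt_log hv0.ne').sub (h0.log (by linarith : (0:ℝ) < 1 - v).ne')
      refine (h1.const_mul (1 / L)).congr_deriv ?_
      simp only [hG]
      have : (1 - v) ≠ 0 := by linarith
      field_simp
      ring
    have hcont : ContinuousOn (fun v => G v / v) (Set.Icc α β) := by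
      refine ContinuousOn.div ?_ continuousOn_id fun v hv => (hv1 v hv).1.ne'
      simp only [hG]
      exact continuousOn_const.div (continuousOn_const.mul (continuousOn_const.sub continuousOn_id))
        fun v hv => by have := (hv1 v hv).2; positivity
    rw [intervalIntegral.integral_eq_sub_of_hasDerivAt hderiv (hcont.intervalIntegrable_of_Icc hαβ)]
    ring
  -- the error factor `≤ 6/L ≤ 3`
  have hGle : ∀ v ∈ Set.Icc α β, 0 ≤ G v ∧ G v ≤ 2 / L := by
    intro v hv
    obtain ⟨hv0, hv1'⟩ := hv1 v hv
    simp only [hG]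
    refine ⟨by positivity, ?_⟩
    rw [div_le_div_iff₀ (by positivity) hL0]
    have := mul_le_mul_of_nonneg_left (le_of_lt hv1') hL0.le
    linarith
  have hIG' : ∫ v in α..β, |G' v| ≤ 2 / L := by
    have hpos : ∀ v ∈ Set.Icc α β, |G' v| = G' v := fun v hv => by
      have := (hv1 v hv).2; exact abs_of_nonneg (by simp only [hG']; positivity)
    have hderiv : ∀ v ∈ Set.uIcc α β, HasDerivAt G (G' v) v := fun v hv => by
      rw [Set.uIcc_of_le hαβ] at hv; exact hGd v hv
    rw [intervalIntegral.integral_congr fun v hv => hpos v (by rwa [Set.uIcc_of_le hαβ] at hv),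
      intervalIntegral.integral_eq_sub_of_hasDerivAt hderiv (hG'c.intervalIntegrable_of_Icc hαβ)]
    linarith [(hGle β ⟨hαβ, le_rfl⟩).2, (hGle α ⟨le_rfl, hαβ⟩).1]
  have hfac : (|G α| + |G β| + ∫ v in α..β, |G' v|) * (CE / Real.log a ^ 2) ≤ 3 * CE / Real.log a ^ 2 := by
    have h1 : |G α| ≤ 2 / L := by
      rw [abs_of_nonneg (hGle α ⟨le_rfl, hαβ⟩).1]; exact (hGle α ⟨le_rfl, hαβ⟩).2
    have h2 : |G β| ≤ 2 / L := by
      rw [abs_of_nonneg (hGle β ⟨hαβ, le_rfl⟩).1]; exact (hGle β ⟨hαβ, le_rfl⟩).2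
    have h3 : 6 / L ≤ 3 := by rw [div_le_iff₀ hL0]; linarith
    calc _ ≤ (6 / L) * (CE / Real.log a ^ 2) := by
          refine mul_le_mul_of_nonneg_right ?_ (by positivity)
          calc |G α| + |G β| + ∫ v in α..β, |G' v| ≤ 2 / L + 2 / L + 2 / L := by linarith
            _ = 6 / L := by ring
      _ ≤ 3 * (CE / Real.log a ^ 2) := mul_le_mul_of_nonneg_right h3 (by positivity)
      _ = 3 * CE / Real.log a ^ 2 := by ring
  have hw := hwrap.trans hfac
  rwa [hmain] at hw

/-! ### The main sum, `k = 2` -/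

/-- **The main prime sum, case `k = 2`** (`ω(s) = 1/s` on the range `1 < s ≤ 2`; the hypotheses
`log x ≤ 3 log y` and `y ≤ p` for the primes of the range put `s = log x/log p − 1` there):
`|∑_p (r(p)/p) ω(log x/log p − 1)/log p − (u ω(u) − 2 ω(2))/log x| ≤ (3 C_E + 12)/log² a`.
[cite: Tenenbaum2015, Ch. III.6] -/
theorem abs_sum_prime_buchstabWeight_sub_main_le_two {r : ℕ → ℝ} {b₀ CE : ℝ}
    (hM : ∀ t : ℝ, 2 ≤ t → |∑ p ∈ Nat.primesLE ⌊t⌋₊, r p / p - (Real.log (Real.log t) + b₀)| ≤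
      CE / Real.log t ^ 2)
    {x y z a b : ℝ} (ha : Real.exp 1 ≤ a) (hay : a ≤ y) (hya : y ≤ a + 1)
    (hab : a ≤ b) (hbz : b < z) (hzb : z ≤ b + 1) (hx : 0 < x) (hz : Real.log z = Real.log x / 2)
    (hu : (2 : ℝ) ≤ Real.log x / Real.log y) (hxy : Real.log x ≤ 3 * Real.log y)
    (hpy : ∀ p ∈ (Finset.Ioc ⌊a⌋₊ ⌊b⌋₊).filter Nat.Prime, y ≤ (p : ℝ)) :
    |∑ p ∈ (Finset.Ioc ⌊a⌋₊ ⌊b⌋₊).filter Nat.Prime,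
        r p / p * (buchstabOmega (Real.log x / Real.log p - 1) / Real.log p) -
      1 / Real.log x * (Real.log x / Real.log y * buchstabOmega (Real.log x / Real.log y) -
        2 * buchstabOmega 2)| ≤ (3 * CE + 12) / Real.log a ^ 2 := by
  set L := Real.log x with hL
  set α := Real.log a / L with hα
  set β := Real.log b / L with hβ
  set S := (Finset.Ioc ⌊a⌋₊ ⌊b⌋₊).filter Nat.Prime with hS
  -- numerics
  have hCE : 0 ≤ CE := mertensConst_nonneg hM
  have ha0 : 0 < a := (Real.exp_pos 1).trans_le ha
  have hla1 : 1 ≤ Real.log a := by rw [Real.le_log_iff_exp_le ha0]; exact ha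
  have hla : 0 < Real.log a := by linarith
  have hy0 : 0 < y := ha0.trans_le hay
  have hb0 : 0 < b := ha0.trans_le hab
  have hz0 : 0 < z := hb0.trans hbz
  have hlay : Real.log a ≤ Real.log y := Real.log_le_log ha0 hay
  have hlab : Real.log a ≤ Real.log b := Real.log_le_log ha0 hab
  have hly : 0 < Real.log y := by linarith
  have hlb : 0 < Real.log b := by linarith
  have hLy : 2 * Real.log y ≤ L := by rwa [le_div_iff₀ hly] at hu
  have hL2 : 2 ≤ L := by nlinarith
  have hL0 : 0 < L := by linarith
  have hlbz : Real.log b < Real.log z := Real.log_lt_log hb0 hbz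
  have hbL : 2 * Real.log b < L := by rw [hz] at hlbz; linarith
  have hα0 : 0 < α := div_pos hla hL0
  have hαL : α * L = Real.log a := by simp only [hα]; field_simp
  have hβL : β * L = Real.log b := by simp only [hβ]; field_simp
  have hβ0 : 0 < β := div_pos hlb hL0
  have hβhalf : β ≤ 1 / 2 := by simp only [hβ]; rw [div_le_iff₀ hL0]; linarith
  -- on the range, `ω(L/log p − 1)/log p = 1/(L − log p)`
  have hsum : ∑ p ∈ S, r p / p * (buchstabOmega (L / Real.log p - 1) / Real.log p) =
      ∑ p ∈ S, r p / p * (1 / (L - Real.log p)) := by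
    refine Finset.sum_congr rfl fun p hp => ?_
    have hpS := Finset.mem_filter.mp hp
    have hp2 : 2 ≤ p := hpS.2.two_le
    have hp0 : (0 : ℝ) < p := by exact_mod_cast (by omega : 0 < p)
    have hlp : 0 < Real.log p := Real.log_pos (by exact_mod_cast (by omega : 1 < p))
    have hpb : (p : ℝ) ≤ b := le_trans (by exact_mod_cast (Finset.mem_Ioc.mp hpS.1).2) (Nat.floor_le hb0.le)
    have hlpz : Real.log p < L / 2 := by rw [← hz]; exact Real.log_lt_log hp0 (hpb.trans_lt hbz)
    have hlpy : Real.log y ≤ Real.log p := Real.log_le_log hy0 (hpy p hp)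
    have hs1 : 1 ≤ L / Real.log p - 1 := by rw [le_sub_iff_add_le, le_div_iff₀ hlp]; linarith
    have hs2 : L / Real.log p - 1 ≤ 2 := by rw [sub_le_iff_le_add, div_le_iff₀ hlp]; nlinarith
    rw [buchstabOmega_eq_inv hs1 hs2]
    have : L - Real.log p ≠ 0 := by linarith
    field_simp
  -- the target `(uω(u) − 2ω(2))/L = log(u − 1)/L`, `u = L/log y ∈ [2, 3]`
  set u := L / Real.log y with hu_def
  have hu3 : u ≤ 3 := by rw [hu_def, div_le_iff₀ hly]; linarith
  have htarget : u * buchstabOmega u - 2 * buchstabOmega 2 = Real.log (u - 1) := by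
    rw [buchstabOmega_eq_of_mem_Icc_two_three hu hu3, buchstabOmega_two]
    have : u ≠ 0 := by linarith
    field_simp
    ring
  -- the three estimates
  have hT1 := abs_sum_prime_div_sub_log_sub_main_le hM ha hab hx hbL hL2
  have hzb' : Real.log z - Real.log b ≤ 1 / a := by
    rw [← Real.log_div hz0.ne' hb0.ne']
    have := Real.log_le_sub_one_of_pos (div_pos hz0 hb0)
    have h2 : z / b - 1 ≤ 1 / a := by
      rw [div_sub_one hb0.ne']
      calc (z - b) / b ≤ 1 / b := by rw [div_le_div_iff_of_pos_right hb0]; linarith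
        _ ≤ 1 / a := one_div_le_one_div_of_le ha0 hab
    linarith
  have hya' : Real.log y - Real.log a ≤ 1 / a := by
    rw [← Real.log_div hy0.ne' ha0.ne']
    have := Real.log_le_sub_one_of_pos (div_pos hy0 ha0)
    have h2 : y / a - 1 ≤ 1 / a := by rw [div_sub_one ha0.ne', div_le_div_iff_of_pos_right ha0]; linarith
    linarith
  -- at `β`
  obtain ⟨hB0, hB1⟩ := log_endpoint_beta_le hβ0 hβhalf
  have hB2 : (1 - 2 * β) / β ≤ 2 / a := by
    have h4 : 1 - 2 * β = 2 * (Real.log z - Real.log b) / L := by simp only [hβ]; rw [hz]; field_simp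
    rw [h4, div_div, div_le_div_iff₀ (by positivity) ha0]
    calc 2 * (Real.log z - Real.log b) * a ≤ 2 * (1 / a) * a := by gcongr
      _ = 2 * 1 := by field_simp
      _ ≤ 2 * (L * β) := by rw [mul_comm L, hβL]; linarith
  -- at `α`
  set α₀ := Real.log y / L with hα₀
  have hαα₀ : α ≤ α₀ := div_le_div_of_nonneg_right hlay hL0.le
  have hα₀h : α₀ ≤ 1 / 2 := by simp only [hα₀]; rw [div_le_iff₀ hL0]; linarith
  have hα₀0 : 0 < α₀ := hα0.trans_le hαα₀
  have hdiff : α₀ - α ≤ 1 / (a * L) := by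
    simp only [hα₀, hα]
    rw [← sub_div, div_le_div_iff₀ hL0 (by positivity)]
    calc (Real.log y - Real.log a) * (a * L) ≤ 1 / a * (a * L) := mul_le_mul_of_nonneg_right hya' (by positivity)
      _ = 1 * L := by field_simp
  obtain ⟨hA0, hA1⟩ := log_endpoint_alpha_le hα0 hαα₀ hα₀h hdiff
  have hA2 : 2 * (1 / (a * L)) + 1 / (a * L) / α ≤ 2 / a := by
    have i3 : 2 * (1 / (a * L)) ≤ 1 / a := by
      rw [show 2 * (1 / (a * L)) = (1 / a) * (2 / L) by field_simp]
      exact mul_le_of_le_one_right (by positivity) (by rw [div_le_one hL0]; exact hL2)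
    have i2 : (1 / (a * L)) / α ≤ 1 / a := by
      calc (1 / (a * L)) / α = 1 / (a * Real.log a) := by rw [div_div, mul_assoc, mul_comm L α, hαL]
        _ ≤ 1 / a := one_div_le_one_div_of_le ha0 (le_mul_of_one_le_right ha0.le hla1)
    have : (2 : ℝ) / a = 1 / a + 1 / a := by ring
    linarith
  have hα₀u : Real.log (u - 1) = Real.log (1 - α₀) - Real.log α₀ := by
    have : u - 1 = (1 - α₀) / α₀ := by simp only [hu_def, hα₀]; field_simp
    rw [this, Real.log_div (by linarith) hα₀0.ne']
  -- `1/a ≤ 4/log² a`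
  have ha4 : 1 / a ≤ 4 / Real.log a ^ 2 := by
    rw [div_le_div_iff₀ ha0 (by positivity), one_mul]
    exact Literature.NumberTheory.Transcendental.log_sq_le_four_mul (by linarith [Real.add_one_le_exp (1:ℝ)])
  -- the mismatch of the main term
  have hmis : |1 / L * ((Real.log β - Real.log (1 - β)) - (Real.log α - Real.log (1 - α))) -
      1 / L * Real.log (u - 1)| ≤ 8 / Real.log a ^ 2 := by
    rw [← mul_sub, abs_mul, abs_of_pos (one_div_pos.mpr hL0), hα₀u]
    have h1 : |(Real.log β - Real.log (1 - β)) - (Real.log α - Real.log (1 - α)) -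
        (Real.log (1 - α₀) - Real.log α₀)| ≤ 4 / a := by
      have hE : (Real.log β - Real.log (1 - β)) - (Real.log α - Real.log (1 - α)) -
          (Real.log (1 - α₀) - Real.log α₀) =
          ((Real.log (1 - α) - Real.log (1 - α₀)) + (Real.log α₀ - Real.log α)) -
            (Real.log (1 - β) - Real.log β) := by ring
      have h4a : (4 : ℝ) / a = 2 / a + 2 / a := by ring
      rw [hE, abs_le]
      constructor <;> linarith
    calc 1 / L * |(Real.log β - Real.log (1 - β)) - (Real.log α - Real.log (1 - α)) -
          (Real.log (1 - α₀) - Real.log α₀)| ≤ 1 / 2 * (4 / a) :=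
          mul_le_mul (one_div_le_one_div_of_le (by norm_num) hL2) h1 (abs_nonneg _) (by norm_num)
      _ = 2 * (1 / a) := by ring
      _ ≤ 2 * (4 / Real.log a ^ 2) := by linarith
      _ = 8 / Real.log a ^ 2 := by ring
  rw [hsum, htarget]
  have htot := abs_sub_le (∑ p ∈ S, r p / p * (1 / (L - Real.log p)))
    (1 / L * ((Real.log β - Real.log (1 - β)) - (Real.log α - Real.log (1 - α))))
    (1 / L * Real.log (u - 1))
  calc _ ≤ 3 * CE / Real.log a ^ 2 + 8 / Real.log a ^ 2 := by linarith
    _ ≤ (3 * CE + 12) / Real.log a ^ 2 := by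
        rw [← add_div]; exact div_le_div_of_nonneg_right (by linarith) (by positivity)

/-! ### The main sum, `k ≥ 2` -/

/-- **The main prime sum of the Buchstab iteration, `ρ`-weighted** (both cases): for `k ≥ 2` and the
Buchstab range `e ≤ a ≤ y ≤ a + 1`, `a ≤ b < z ≤ b + 1`, `log z = (log x)/k`, `k ≤ u = log x/log y`,
`log x ≤ (k+1) log y`, `log x ≤ 2(k+1) log a`, primes of the range `≥ y`:
`|∑_{⌊a⌋ < p ≤ ⌊b⌋} (r(p)/p) ω(log x/log p − 1)/log p − (u ω(u) − k ω(k))/log x| ≤ K/log² a`,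
`K = (2 + (k+3)³) C_E + 12 + 4k`. [cite: Tenenbaum2015, Ch. III.6] -/
theorem abs_sum_prime_buchstabWeight_sub_main_le {r : ℕ → ℝ} {b₀ CE : ℝ}
    (hM : ∀ t : ℝ, 2 ≤ t → |∑ p ∈ Nat.primesLE ⌊t⌋₊, r p / p - (Real.log (Real.log t) + b₀)| ≤
      CE / Real.log t ^ 2)
    {k : ℕ} (hk : 2 ≤ k) {x y z a b : ℝ} (ha : Real.exp 1 ≤ a) (hay : a ≤ y) (hya : y ≤ a + 1)
    (hab : a ≤ b) (hbz : b < z) (hzb : z ≤ b + 1) (hx : 0 < x) (hz : Real.log z = Real.log x / k)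
    (hu : (k : ℝ) ≤ Real.log x / Real.log y) (hxy : Real.log x ≤ (k + 1) * Real.log y)
    (hxa : Real.log x ≤ 2 * (k + 1) * Real.log a)
    (hpy : ∀ p ∈ (Finset.Ioc ⌊a⌋₊ ⌊b⌋₊).filter Nat.Prime, y ≤ (p : ℝ)) :
    |∑ p ∈ (Finset.Ioc ⌊a⌋₊ ⌊b⌋₊).filter Nat.Prime,
        r p / p * (buchstabOmega (Real.log x / Real.log p - 1) / Real.log p) -
      1 / Real.log x * (Real.log x / Real.log y * buchstabOmega (Real.log x / Real.log y) -
        k * buchstabOmega k)| ≤ ((2 + (k + 3) ^ 3) * CE + 12 + 4 * k) / Real.log a ^ 2 := by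
  have hCE : 0 ≤ CE := mertensConst_nonneg hM
  have ha0 : 0 < a := (Real.exp_pos 1).trans_le ha
  have hla : 0 < Real.log a := by
    have : 1 ≤ Real.log a := by rw [Real.le_log_iff_exp_le ha0]; exact ha
    linarith
  have hla2 : 0 < Real.log a ^ 2 := by positivity
  rcases Nat.lt_or_ge k 3 with hk3 | hk3
  · have hk2 : k = 2 := by omega
    subst hk2
    have h := abs_sum_prime_buchstabWeight_sub_main_le_two hM ha hay hya hab hbz hzb hx
      (by simpa using hz) (by simpa using hu) (by norm_num at hxy; linarith) hpy
    refine (le_of_eq ?_).trans (h.trans (div_le_div_of_nonneg_right (by norm_num; nlinarith) hla2.le))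
    norm_num
  · have h := abs_sum_prime_buchstabWeight_sub_main_le_of_three_le hM hk3 ha hay hya hab hbz hzb
      hx hz hu hxa
    exact h.trans (div_le_div_of_nonneg_right (by nlinarith) hla2.le)

end FriableMoebiusRoot

end Literature.NumberTheory.Sieve
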